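import Summits.CriticalPhenomena.PercolationContinuityZ3.Theorems.Transplant.PlanarSkeletonFrmFromDefs
import Summits.CriticalPhenomena.PercolationContinuityZ3.Theorems.Transplant.SkelFrmFrom1ReachHoldsQ3V
import Summits.CriticalPhenomena.PercolationContinuityZ3.Theorems.Transplant.SkelFrm1ReachHoldsQ3V
import Summits.CriticalPhenomena.PercolationContinuityZ3.Theorems.Transplant.SkelFrmFromBChoiceResidQV
import Summits.CriticalPhenomena.PercolationContinuityZ3.Theorems.Transplant.SkelFrmBChoiceResidQV
import HarnessLib
import Summits.CriticalPhenomena.PercolationContinuityZ3.Theorems.Transplant.SkelFrm1ReachHoldsQ3VNode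
/-!
# U-WAVE PORT (RULING D-U, lead g21 2026-08-26; WAVE-U-MANIFEST v3.0 row «SkelFrm1ReachHoldsQ3VNode» ↦ «SkelFrmFrom1ReachHoldsQ3VNode») of the tree module
# `Transplant/SkelFrm1ReachHoldsQ3VNode` onto the carrier `PlanarSkeletonFrmFrom` (frames only, cylinders connected from width `ℓ₀` on)

ORIGINAL TITLE: N2 (frames-only node `SamePDropOfSkeletonFrm₁`, OPEN), (C) column, THE TARGET OF RECORD (step 2, thin instance at the node tuple):

builds on p205010 (kernel theorem, internal audit signed; external expert review pending) — nothing in this file uses p205010; NOTHING is claimed about the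
OPEN node U `SamePDropOfSkeletonFrmFrom₁` (nor U_s / the end state).  Lane `prim-bschramm`, seat `prim-bschramm-p3` gen 26; helper file
(`--supports stmt-CriticalPhenomena-4575 --as helper`).  PORT RULES r1–r4 of RULING D-U: declaration order and proof texts are those of the original,
byte-identical except (i) the carrier token `PlanarSkeletonFrm ↦ PlanarSkeletonFrmFrom` (binders, `namespace`/`end` lines, qualified names of twinned
declarations), (ii) carrier-FREE declarations of the original (φ-level `Skelφ…` blocks and namespace-only arithmetic residents) are NOT re-declared —
this file imports the original and `export`s the twin-free residents (POLICY T / treatment (m1)); residents whose statement mentions a twinned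
constant are copied, (iii) every carrier-binding declaration keeps its explicit binder `(Φ : PlanarSkeletonFrmFrom G)` in its own signature (r2).  Docstrings and citations are the original's.
-/

open scoped Classical

noncomputable section

namespace Summit.CriticalPhenomena.PercolationContinuityZ3.Theorems.Transplant

namespace PlanarSkeletonFrmFrom

open Literature.Probability.Percolation Literature.Probability.LatticeModels SimpleGraph
open SkelConc (Consts)

/-- **THE (C) COLUMN TARGET OF RECORD AT THE NODE TUPLE** (K-floor `Kmin ≥ 160` as a parameter — node₂ takes `Kmin := 480` (J27); kit index `mk := 0`, window
`BSlot.small3 = (76·s₀, 19·s₁)`, creep `cR2W 0`, forward room `hFR 0`), parametric in the (R) column's residual slot functions.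
[cite: KozmaNitzan2024, §4 Lemma 12 (pp. 23–25), p. 30 (Step IV)] -/
theorem reachHoldsRHNQFnLK_frmChoiceAllQ3V (Kmin : ℕ) (hKmin : 160 ≤ Kmin) (gxR fxR : PlanarSkeletonFrmFrom.Neg.FSlot) (exR mxR : NegB.GSlot) (PxR : NegB.PSlot) :
    ReachHoldsRHNQFnLK NegB.LfQ Kmin
      (frmChoiceAllQ3V (NegB.KS.gT 0 (NegB.gxQ 0 gxR fxR)) (NegB.KS.fT 0 (NegB.fxQ 0 fxR)) (NegB.KS.PR 0 (NegB.PxQ 0 PxR))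
        (NegB.SUS (NegB.exQ 0 exR) (NegB.mxQ mxR)) (NegB.cR2W 0) (NegB.hFR 0) NegB.BSlot.small3) :=
  reachHoldsRHNQFnLK_frmChoiceAllQ3V_of_le Kmin hKmin 0
    (fun _ _ _ _ _ _ _ _ _ D => NegB.Hg_Q 0 gxR fxR D)
    (fun _ _ _ _ _ _ _ _ _ D g f => NegB.Hex_Q 0 exR D g f)
    (fun _ _ _ _ _ _ _ _ _ D g f => NegB.HexY_Q 0 exR D g f)

end PlanarSkeletonFrmFrom

end Summit.CriticalPhenomena.PercolationContinuityZ3.Theorems.Transplant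

end
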